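import Literature.IUT.LogVolume.PrincipalArithmeticDivisors
import Literature.IUT.LogVolume.IdealArithmeticDivisors
import Literature.AlgebraicGeometry.Frobenioids.ArithmeticDivisors
import HarnessLib

/-!
# One group of arithmetic divisors: [FrdI] Ex. 6.3's `Φ(F)^gp` (Frobenioid side) inside
# [IUTchIV] Def. 1.9 / [GenEll] §1's `ADiv_ℝ(F)` (log-volume side) — principal divisors and degrees agree

The cell types the arithmetic divisors of a number field `F` twice, faithfully to two texts:
* `Literature.AlgebraicGeometry.Frobenioids.ArithDivisor F = (FinitePlace F →₀ ℤ) × (InfinitePlace F → ℝ)`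
  with `principalArithDivisor`, `arithDegree` ([FrdI] Ex. 6.3 pp. 112–114: `Φ(F)^gp = ⊕_v ord(F_v)`, the
  archimedean coordinate of `λ` being `t = −log|λ|_v`, of degree `[F_v:ℝ]·t`);
* `Literature.IUT.LogVolume.ADivisor F = (InfinitePlace F ⊕ HeightOneSpectrum (𝓞 F)) →₀ ℝ` with `degF`
  ([IUTchIV] Def. 1.9 (i) p. 21: `deg_F(v) = log q_v`, resp. `1`) and `ADivisor.principal` ([GenEll] §1
  p. 4: archimedean coefficient `−[F_v:ℝ]·log|f|_v`).
This file is the comparison `ofArithDivisor : Φ(F)^gp →+ ADiv_ℝ(F)` — `(n_w)_w ↦ Σ n_w·v(w)` at the finite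
places (`v(w)` = the maximal ideal of Mathlib's finite place `w`), `(t_v)_v ↦ Σ [F_v:ℝ]·t_v·v` at the
archimedean ones — and PROVES that it is injective, carries `div(f)` to `ADiv(f)`
(`ofArithDivisor_principalArithDivisor`) and `deg^arith` to `deg_F` (`degF_ofArithDivisor`); in
particular [FrdI]'s "`deg^arith` vanishes on `B(F)`" and [GenEll]'s `deg_F(ADiv(f)) = 0` are the same
product formula (`degF_principal_eq_arithDegree`). [cite: MochizukiGenEll2010, §1 p.4]
[cite: MochizukiFrdI2008, Ex. 6.3 p.113]
-/

noncomputable section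

namespace Literature.IUT.LogVolume

open NumberField IsDedekindDomain Finset
open Literature.AlgebraicGeometry.Frobenioids

variable (F : Type*) [Field F] [NumberField F]

namespace ADivisor

/-- Finite coordinates: `(n_w)_{w} ↦ (n_{w(v)})_v` re-indexed by maximal ideals, coefficients cast to `ℝ`.
[cite: MochizukiGenEll2010, §1 p.4] -/
def finOfArith : (FinitePlace F →₀ ℤ) →+ (HeightOneSpectrum (𝓞 F) →₀ ℝ) :=
  (Finsupp.mapDomain.addMonoidHom FinitePlace.maximalIdeal).comp
    (Finsupp.mapRange.addMonoidHom (Int.castAddHom ℝ))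

/-- `finOfArith n v = n_{w}` for the finite place `w` of `v`. [cite: MochizukiGenEll2010, §1 p.4] -/
@[simp] theorem finOfArith_apply (n : FinitePlace F →₀ ℤ) (v : HeightOneSpectrum (𝓞 F)) :
    finOfArith F n v = (n (FinitePlace.mk v) : ℝ) := by
  simp only [finOfArith, AddMonoidHom.coe_comp, Function.comp_apply,
    Finsupp.mapRange.addMonoidHom_apply, Finsupp.mapDomain.addMonoidHom_apply]
  conv_lhs => rw [← FinitePlace.maximalIdeal_mk v]
  rw [Finsupp.mapDomain_apply FinitePlace.maximalIdeal_injective, Finsupp.mapRange_apply]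
  rfl

/-- Archimedean coordinates: `(t_v)_v ↦ ([F_v:ℝ]·t_v)_v`. [cite: MochizukiGenEll2010, §1 p.4] -/
def archOfArith : (InfinitePlace F → ℝ) →+ (InfinitePlace F →₀ ℝ) where
  toFun t := Finsupp.equivFunOnFinite.symm fun w => (w.mult : ℝ) * t w
  map_zero' := by ext w; simp
  map_add' s t := by ext w; simp [mul_add]

/-- `archOfArith t v = [F_v:ℝ]·t_v`. [cite: MochizukiGenEll2010, §1 p.4] -/
@[simp] theorem archOfArith_apply (t : InfinitePlace F → ℝ) (w : InfinitePlace F) :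
    archOfArith F t w = (w.mult : ℝ) * t w := rfl

/-- **The comparison map `Φ(F)^gp → ADiv_ℝ(F)`.** [cite: MochizukiGenEll2010, §1 p.4] -/
def ofArithDivisor : ArithDivisor F →+ ADivisor F where
  toFun d := (archOfArith F d.2).sumElim (finOfArith F d.1)
  map_zero' := by
    ext (w | v) <;> simp
  map_add' d e := by
    rw [Prod.fst_add, Prod.snd_add, map_add, map_add, Finsupp.sumElim_add]

/-- Archimedean coefficients of the comparison. [cite: MochizukiGenEll2010, §1 p.4] -/
@[simp] theorem ofArithDivisor_apply_inl (d : ArithDivisor F) (w : InfinitePlace F) :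
    ofArithDivisor F d (Sum.inl w) = (w.mult : ℝ) * d.2 w := rfl

/-- Finite coefficients of the comparison. [cite: MochizukiGenEll2010, §1 p.4] -/
@[simp] theorem ofArithDivisor_apply_inr (d : ArithDivisor F) (v : HeightOneSpectrum (𝓞 F)) :
    ofArithDivisor F d (Sum.inr v) = (d.1 (FinitePlace.mk v) : ℝ) := by
  change finOfArith F d.1 v = _
  exact finOfArith_apply F d.1 v

/-- The comparison is injective (`[F_v:ℝ] ≠ 0`, `ℤ ↪ ℝ`, `w ↦ v(w)` bijective).
[cite: MochizukiGenEll2010, §1 p.4] -/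
theorem ofArithDivisor_injective : Function.Injective (ofArithDivisor F) := by
  intro d e h
  refine Prod.ext (Finsupp.ext fun w => ?_) (funext fun w => ?_)
  · have := congrArg (fun a : ADivisor F => a (Sum.inr w.maximalIdeal)) h
    simp only [ofArithDivisor_apply_inr, FinitePlace.mk_maximalIdeal] at this
    exact_mod_cast this
  · have := congrArg (fun a : ADivisor F => a (Sum.inl w)) h
    simp only [ofArithDivisor_apply_inl] at this
    exact mul_left_cancel₀ InfinitePlace.mult_coe_ne_zero this

end ADivisor

/-- The two `ord_v`'s agree: [FrdI]'s `ordFin w` (at Mathlib's finite place `w = w(v)`) and the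
LogVolume `ord F v`. [cite: MochizukiGenEll2010, §1 p.4] -/
theorem ordFin_mk_eq_ord (v : HeightOneSpectrum (𝓞 F)) (x : Fˣ) :
    ordFin F (FinitePlace.mk v) x = ord F v x := by
  have hN : (1 : ℝ) < (Ideal.absNorm v.asIdeal : ℝ) := by
    exact_mod_cast NumberField.HeightOneSpectrum.one_lt_absNorm v
  have h1 := apply_eq_absNorm_zpow (FinitePlace.mk v) x
  rw [FinitePlace.maximalIdeal_mk, FinitePlace.mk_apply, FinitePlace.norm_embedding,
    adicAbv_eq_absNorm_zpow F v x.ne_zero] at h1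
  have := zpow_right_injective₀ (zero_lt_one.trans hN) hN.ne' h1
  simpa using this.symm

/-- **`div(f) ↦ ADiv(f)`**: the comparison carries [FrdI]'s principal divisor to [GenEll]'s.
[cite: MochizukiGenEll2010, §1 p.4] -/
theorem ofArithDivisor_principalArithDivisor (x : Fˣ) :
    ADivisor.ofArithDivisor F (principalArithDivisor F x) = ADivisor.principal (x : F) := by
  ext (w | v)
  · rw [ADivisor.ofArithDivisor_apply_inl, principalArithDivisor_snd, ADivisor.principal_apply_inl]
    ring
  · rw [ADivisor.ofArithDivisor_apply_inr, principalArithDivisor_fst, ADivisor.principal_apply_inr,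
      ordFin_mk_eq_ord]

/-- **`deg_F ∘ (comparison) = deg^arith`**: the two degree maps agree. [cite: MochizukiGenEll2010, §1 p.4] -/
theorem degF_ofArithDivisor (d : ArithDivisor F) :
    degF F (ADivisor.ofArithDivisor F d) = arithDegree F d := by
  rw [arithDegree_apply, degF_apply, ADivisor.ofArithDivisor]
  change ((ADivisor.archOfArith F d.2).sumElim (ADivisor.finOfArith F d.1)).sum
      (fun v c => c * degWeight F v) = _
  rw [Finsupp.sum_sumElim, add_comm]
  congr 1
  · -- finite part
    rw [ADivisor.finOfArith, AddMonoidHom.coe_comp, Function.comp_apply,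
      Finsupp.mapDomain.addMonoidHom_apply, Finsupp.mapRange.addMonoidHom_apply,
      Finsupp.sum_mapDomain_index_inj FinitePlace.maximalIdeal_injective,
      Finsupp.sum_mapRange_index (fun _ => by simp)]
    refine Finsupp.sum_congr fun w _ => ?_
    simp [logNorm]
  · -- archimedean part
    rw [Finsupp.sum_fintype _ _ (fun _ => by simp)]
    simp

/-- Hence [GenEll]'s `deg_F(ADiv(f)) = 0` and [FrdI]'s "`deg^arith` vanishes on `B(F)`" are one statement
(the product formula); here the former re-derived from the latter. [cite: MochizukiGenEll2010, §1 p.4] -/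
theorem degF_principal_eq_arithDegree (x : Fˣ) :
    degF F (ADivisor.principal (x : F)) = arithDegree F (principalArithDivisor F x) := by
  rw [← ofArithDivisor_principalArithDivisor, degF_ofArithDivisor]

/-! ### `ADiv((x))` for an algebraic integer `x`: the ideal divisor is the finite part of `ADiv(x)` -/

namespace ADivisor

variable {F}

/-- For `x ∈ O_F ∖ 0` the divisor of `(x)` is the finite part of `ADiv(x)`: `ord_v((x)) = ord_v(x)`.
[cite: MochizukiGenEll2010, Def. 1.5 (iii) p.9] -/
theorem ofIdeal_span_singleton_apply_inr {x : 𝓞 F} (hx : x ≠ 0) (v : HeightOneSpectrum (𝓞 F)) :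
    ofIdeal (Ideal.span {x}) (Sum.inr v) = principal (x : F) (Sum.inr v) := by
  have hsx : Ideal.span {x} ≠ ⊥ := by simpa [Ideal.span_singleton_eq_bot] using hx
  rw [ofIdeal_apply_inr hsx, principal_apply_inr, ord]
  rw [show (x : F) = algebraMap (𝓞 F) F x from rfl, HeightOneSpectrum.valuation_of_algebraMap,
    HeightOneSpectrum.intValuation_eq_exp_neg_multiplicity v hx, WithZero.log_exp]
  push_cast
  ring

end ADivisor

end Literature.IUT.LogVolume

end
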